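import Summits.KontsevichZagierPeriods.KontsevichZagierPeriods.Theses.FurushoPentagon
import Literature.NumberTheory.Transcendental.KZKernelConjectureForms
import Literature.NumberTheory.Transcendental.KZLogCalculusProofs

/-!
# `ReducedPeriodRing` (stmt-KontsevichZagierPeriods-3929) — independence models and the anatomy of a witness

* Independence over the abstract interface (commutative ring + evaluation character): the reduced
  model `ℝ` (`abstract_interface_admits_reduced`; the non-reduced dual numbers are in
  `Negative/LoadBearing.lean`), and the exact algebraic shape of route Neg's square-root gaps /
  `CancellationGap` / Das-type Γ-monomial witnesses — `x² = y²`, `x ≠ y`, `ev x = ev y` — realised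
  in the REDUCED ring `ℚ × ℚ = ℚ[ℤ/2]` (`sqrtGap_model`): such witnesses are zero-divisors /
  idempotents, never nilpotents, so they cannot refute this crux (cf. Poonen, Math. Res. Lett. 9
  (2002), §5: `([A]+[B])([A]−[B]) = 0` in `K₀(Var_k)` from `A × A ≅ B × B`, `A ≇ B`; Cresson–Viu-Sos,
  JTNB 2022, Rem. 2.3 asks only whether `K₀(𝒞_saq)` has zero-divisors).
* Anatomy: the only door to a nilpotent is a COMMON SQUARE one Fubini level up
  (`sq_sub_mem_relations_of_common_square`; the crux is exactly the licence to extract the root,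
  `sub_mem_relations_of_common_square`); `¬crux` ⇔ a pair `r ≁ r'` with
  `([r] − [r'])² ∈ relations` (`not_reducedPeriodRing_iff_pair`) ⇔ ONE representation `u` with
  `[u ⊠ u] ∈ relations`, `[u] ∉ relations` (`not_reducedPeriodRing_iff_single`, via
  `exists_sub_of_mem_relations`: every formal period is the class of one signed representation);
  by `Negative/PositiveCone.lean` the integrand of such a `u` must change sign.
cdisprove (refuter) file. [Kontsevich–Zagier 2001, §1.2, §4.1]
-/

noncomputable section

namespace Summit.KontsevichZagierPeriods.KontsevichZagierPeriods.ReducedPeriodRingNegative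

open Literature.NumberTheory.Transcendental KZ
open Summit.KontsevichZagierPeriods.KontsevichZagierPeriods.Theses.FurushoPentagon

section Models

/-- **Square-root gaps are not nilpotents**: a REDUCED commutative ring with an evaluation
character `ev` and two elements `x ≠ y` with `ev x = ev y` and `x² = y²` (so `(x − y)(x + y) = 0`
with `ev (x + y) ≠ 0`: cancellation fails, a zero-divisor and the idempotent `(1 + xy⁻¹)/2`
appear) — `ℚ × ℚ = ℚ[ℤ/2]`, `x = 1`, `y = g`. This is the exact algebraic shape of Neg's
`CancellationGap` / Das-type Γ-monomial witnesses; they cannot refute THIS crux. [folklore] -/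
theorem sqrtGap_model :
    ∃ (R : Type) (_ : CommRing R) (ev : R →+* ℚ) (x y : R), IsReduced R ∧
      ev x = ev y ∧ x ^ 2 = y ^ 2 ∧ x ≠ y ∧ (x - y) * (x + y) = 0 ∧ ev (x + y) ≠ 0 := by
  refine ⟨ℚ × ℚ, inferInstance, RingHom.fst ℚ ℚ, (1, 1), (1, -1), inferInstance, ?_, ?_, ?_, ?_, ?_⟩
  · simp
  · ext <;> simp
  · norm_num [Prod.ext_iff]
  · ext <;> simp
  · simp

/-- The reduced model `ℝ` (injective evaluation): the abstract interface does not REFUTE the crux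
either. [folklore] -/
theorem abstract_interface_admits_reduced :
    ∃ (R : Type) (_ : CommRing R) (ev : R →+* ℝ), Function.Injective ev ∧ IsReduced R :=
  ⟨ℝ, inferInstance, RingHom.id ℝ, fun _ _ h => h, inferInstance⟩

end Models

section Anatomy

/-- **The only door: a common square.** [folklore] -/
theorem sq_sub_mem_relations_of_common_square {a b s : FormalRep} (haa : a * a - s ∈ relations)
    (hbb : b * b - s ∈ relations) (hab : a * b - s ∈ relations) :
    (a - b) * (a - b) ∈ relations := by
  have hba : b * a - s ∈ relations := by
    have := relations.add_mem (mul_sub_mul_comm_mem_relations b a) hab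
    simpa using this
  have heq : (a - b) * (a - b) = (a * a - s) + (b * b - s) - (a * b - s) - (b * a - s) := by
    simp only [sub_mul, mul_sub]; abel
  rw [heq]
  exact relations.sub_mem (relations.sub_mem (relations.add_mem haa hbb) hab) hba

/-- Conversely the crux turns every common-square triple into an equivalence `a ∼ b`: this is the
"formal square-root extraction" the crux buys (and all it buys). [folklore] -/
theorem sub_mem_relations_of_common_square (h : ReducedPeriodRing) {a b s : FormalRep}
    (haa : a * a - s ∈ relations) (hbb : b * b - s ∈ relations) (hab : a * b - s ∈ relations) :
    a - b ∈ relations :=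
  h _ (sq_sub_mem_relations_of_common_square haa hbb hab)

/-- The two-representation form of a witness: `¬ crux` iff some pair of single representations
`r ≁ r'` (of possibly different dimensions) has `([r] − [r'])² ∈ relations` — by
`KZ.exists_integralRep_sub` every formal combination is `[r] − [r']` modulo relations. [folklore] -/
theorem not_reducedPeriodRing_iff_pair :
    ¬ ReducedPeriodRing ↔ ∃ (n m : ℕ) (r : IntegralRep n) (r' : IntegralRep m),
      (of r - of r') * (of r - of r') ∈ relations ∧ ¬ Equivalent r r' := by
  constructor
  · intro h
    obtain ⟨c, hc⟩ := not_forall.mp h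
    obtain ⟨hcc, hcn⟩ := Classical.not_imp.mp hc
    obtain ⟨n, m, r, r', hd⟩ := exists_integralRep_sub_holds c
    refine ⟨n, m, r, r', ?_, fun he => hcn ?_⟩
    · have hd' : (of r - of r') - c ∈ relations := by
        simpa using relations.neg_mem hd
      have h1 := mul_sub_mul_mem_relations hd' hd'
      have := relations.add_mem h1 hcc
      simpa using this
    · have := relations.add_mem hd he
      simpa using this
  · rintro ⟨n, m, r, r', hsq, hne⟩ h
    exact hne (h _ hsq)

/-- **Every formal period is the class of ONE (signed) representation**: `c ∼ [r] − [r']`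
(`KZ.exists_integralRep_sub`) and `[r] + [r'.neg]` merge into one representation
(`KZ.IntegralRep.exists_of_add_of_sub_of_mem_relations`). [Kontsevich–Zagier 2001, §1.2] -/
theorem exists_sub_of_mem_relations (c : FormalRep) :
    ∃ (N : ℕ) (R : IntegralRep N), c - of R ∈ relations := by
  obtain ⟨n, m, r, r', hd⟩ := exists_integralRep_sub_holds c
  obtain ⟨N, R, hR⟩ := IntegralRep.exists_of_add_of_sub_of_mem_relations r r'.neg
  refine ⟨N, R, ?_⟩
  have hneg : of r' + of r'.neg ∈ relations :=
    of_add_of_mem_relations_of_eqOn_neg (r := r') (r' := r'.neg) rfl (fun _ _ => rfl)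
  have heq : c - of R = (c - (of r - of r')) + (of r + of r'.neg - of R) - (of r' + of r'.neg) := by
    abel
  rw [heq]
  exact relations.sub_mem (relations.add_mem hd hR) hneg

/-- **Single-representation form of a witness** (the form ideator 3's card uses): `¬ crux` iff ONE
representation `u = [σ, f]` has `[σ × σ, f ⊗ f] ∈ relations` but `[σ, f] ∉ relations`. [folklore] -/
theorem not_reducedPeriodRing_iff_single :
    ¬ ReducedPeriodRing ↔
      ∃ (N : ℕ) (u : IntegralRep N), of (u.prod u) ∈ relations ∧ of u ∉ relations := by
  constructor
  · intro h
    obtain ⟨c, hc⟩ := not_forall.mp h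
    obtain ⟨hcc, hcn⟩ := Classical.not_imp.mp hc
    obtain ⟨N, u, hu⟩ := exists_sub_of_mem_relations c
    refine ⟨N, u, ?_, fun hu0 => hcn ?_⟩
    · have hd' : of u - c ∈ relations := by simpa using relations.neg_mem hu
      have h1 := mul_sub_mul_mem_relations hd' hd'
      rw [of_mul_of] at h1
      have := relations.add_mem h1 hcc
      simpa using this
    · have := relations.add_mem hu hu0
      simpa using this
  · rintro ⟨N, u, hsq, hne⟩ h
    exact hne (h _ (by rw [of_mul_of]; exact hsq))

end Anatomy

end Summit.KontsevichZagierPeriods.KontsevichZagierPeriods.ReducedPeriodRingNegative
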